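import Literature.IUT.HodgeTheaters.TemperedCoveringsProSigmaInertia
import HarnessLib

/-!
# [IUTchI] Cor. 2.5 from Prop. 2.4 and the [SemiAnbd] §6 decomposition-group data BY NAME, PROOFS

Mochizuki, *Inter-universal Teichmüller theory I*, kurims manuscript (May 2020), §2, Cor. 2.5 and its
proof, p. 51 [cite: Mochizuki2012, Cor 2.5 p.51] (D-0012 claim key; series status DISPUTED — nothing
on this page is contested).  PROOF-ONLY file (abc-iut-L5-t11; no definitions, nothing printed is
asserted) pinning the RESIDUAL of the typed Cor. 2.5 (`StableCurveTemperedData.Cor25Decomposition` /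
`Cor25Inertia`, abc-iut-L5-t1) to named inputs.  The printed proof uses, besides Prop. 2.4 (i)/(ii):
"`D_x` is compact" — NO supplier in the tree (GAP-LEDGER G-L5t11g4-1: a field missing on the [SemiAnbd]
§6 interface `TemperedCurve`), kept as the hypothesis `hc`; "surjects onto an open subgroup of
`G_k`" — the [SemiAnbd] §6 p. 71 field `TemperedCurve.isOpen_aug_decomp`, hypothesis `ho`, from
which "`D_x ≠ 1`" FOLLOWS once `G_k` is an infinite profinite [compact] group
(`decompTp_ne_bot_of_isOpen_map`); and "`I_x ≅ Ẑ(1)`" — the field `TemperedCurve.inertia_equiv_zHat`,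
hypothesis `e`, which yields the pro-`Σ` atom (`TemperedCoveringsProSigmaInertia`).  Net
(`cor25_byName`): Cor. 2.5 AS TYPED ⇐ Prop. 2.4 (i), (ii) ∧ `D_x` compact ∧ `D_x ↠` open `⊆ G_k` ∧
`I_x ≃ₜ* Ẑ` ∧ `G_k` a compact infinite topological group ∧ `X` has a point and a cusp.
-/

namespace Literature.IUT.HodgeTheaters

open Pointwise Topology
open Literature.AnabelianGeometry.SemiGraphs (IsProSigma)

universe u

namespace StableCurveTemperedData

variable (D : StableCurveTemperedData.{u})

/-- "`D_x` … surjects onto an open subgroup of `G_k`" ⇒ `D_x ≠ {1}` when `G_k` is compact and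
infinite, as a topological group (an open subgroup of an infinite compact group is nontrivial: `{1}`
open would make `G_k` discrete, hence finite). [cite: Mochizuki2012, Cor 2.5 p.51] -/
theorem decompTp_ne_bot_of_isOpen_map [IsTopologicalGroup D.Gk] [CompactSpace D.Gk] [Infinite D.Gk]
    (x : D.Pt)
    (ho : IsOpen ((D.decompTp x).map D.prTp : Set D.Gk)) : D.decompTp x ≠ ⊥ := by
  intro hbot
  rw [hbot, Subgroup.map_bot, Subgroup.coe_bot] at ho
  haveI : DiscreteTopology D.Gk := discreteTopology_iff_isOpen_singleton_one.mpr ho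
  haveI : Finite D.Gk := finite_of_compact_of_discrete
  exact not_finite D.Gk

/-- **Cor. 2.5 (decomposition groups) BY NAME**: from Prop. 2.4 (ii), "`D_x` is compact" (`hc`, no
tree supplier — GAP-LEDGER G-L5t11g4-1), "`D_x` surjects onto an open subgroup of `G_k`" (`ho`,
[SemiAnbd] §6 p. 71) with `G_k` compact infinite, and "`X` has a closed point or cusp".
[cite: Mochizuki2012, Cor 2.5 p.51] -/
theorem cor25Decomposition_byName (h : D.Prop24ii) [Nonempty D.Pt] [IsTopologicalGroup D.Gk]
    [CompactSpace D.Gk] [Infinite D.Gk] (hc : ∀ x : D.Pt, IsCompact (D.decompTp x : Set D.PiTp))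
    (ho : ∀ x : D.Pt, IsOpen ((D.decompTp x).map D.prTp : Set D.Gk)) : D.Cor25Decomposition :=
  D.cor25Decomposition_of_prop24ii h fun x => ⟨hc x, D.decompTp_ne_bot_of_isOpen_map x (ho x), ho x⟩

/-- **Cor. 2.5 (both readings) BY NAME**: Prop. 2.4 (i) and (ii) for the datum; the [SemiAnbd] §6
decomposition-group data — `D_x` compact (`hc`, GAP-LEDGER G-L5t11g4-1), `D_x ↠` an open subgroup of
the infinite profinite `G_k` (`ho`), `I_x ≅ Ẑ(1)` as topological groups (`e`) — and "`X` has a closed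
point and a cusp".  [The inertia half is `cor25Inertia_of_prop24i_of_equiv_zHat`.]
[cite: Mochizuki2012, Cor 2.5 p.51] -/
theorem cor25_byName (h24i : D.Prop24i) (h24ii : D.Prop24ii) [Nonempty D.Pt] [Nonempty D.Cusp]
    [IsTopologicalGroup D.Gk] [CompactSpace D.Gk] [Infinite D.Gk]
    (hc : ∀ x : D.Pt, IsCompact (D.decompTp x : Set D.PiTp))
    (ho : ∀ x : D.Pt, IsOpen ((D.decompTp x).map D.prTp : Set D.Gk))
    (e : ∀ x : D.Cusp, ↥(D.inertiaTp x) ≃ₜ* ZHat) :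
    D.Cor25Decomposition ∧ D.Cor25Inertia :=
  ⟨D.cor25Decomposition_byName h24ii hc ho, D.cor25Inertia_of_prop24i_of_equiv_zHat h24i e⟩

end StableCurveTemperedData

end Literature.IUT.HodgeTheaters
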